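import Literature.Probability.RandomPlanarGeometry.SLETraceKappaLimit
import Literature.Probability.RandomPlanarGeometry.CritPercSLESwallowingProofs
import Literature.Probability.RandomPlanarGeometry.CaratheodoryHalfPlaneProofs
import Literature.Probability.RandomPlanarGeometry.LoewnerDescriptionProofs
import Literature.Probability.RandomPlanarGeometry.DrivingFunctionMeasurable
import Literature.Probability.RandomPlanarGeometry.LocalMartingaleProofs
import Literature.Probability.RandomPlanarGeometry.SLERestrictionMartingale
import Mathlib.MeasureTheory.Constructions.BorelSpace.Metric
import HarnessLib

/-!
# `stub_slePor` — porosity of the SLE(8/3) reference arc (crux `PathUpgradeR`,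
stmt-CriticalPhenomena-18055, route `SAWReversalUpgrade`, line `bidir_windows`)

Landing target:
`Summits/CriticalPhenomena/SAWScalingLimit/Theorems/SAWReversalUpgradePathUpgradeRSLEPor.lean`
(`--supports stmt-CriticalPhenomena-18055`; registered stub `stub_slePor`).

The registered theorem `stub_slePor` is a quantile lemma for the SLE(8/3) reference sample
`γ = sleTrace (8/3) ω` seen in a Dobrushin domain `E` through the boundary extension `ψ̄` of a
chordal uniformizer `ψ : ℍ ≃ E`, `r := ψ̄ ∘ γ`: for every horizon `T`, every `dS > 0` and every
budget `β > 0` there is a deterministic `d' > 0` such that the BAD event "for some `u ≤ T + 1`,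
every point `e ∈ E` with `dist e (r u) ≤ dS` is at distance `< d'` from
`F := r '' [0, T + 1] ∪ ∂E`" has `P'`-measure at most `β`.

Proof (sub-namespace `PathUpgradeRSLERegPor`, general `0 < κ < 8`). Almost surely the range of the
trace has empty interior (`ae_interior_range_sleTrace_eq_empty_of_lt_eight`, Rohde–Schramm). For
such a sample no nonempty open subset of `E` is covered by `r` (pull back through `ψ`, using the
injectivity of `ψ̄` on the closed half-plane, `JordanDomain.injOn_boundaryExtension`), and
`r u ∈ closure E` (Carathéodory, `JordanDomain.mapsTo_boundaryExtension_holds`); hence near every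
`r u` there is a point of a fixed countable dense set `Q ⊆ ℂ`, inside `E`, off the closed set `F`,
i.e. at positive distance from `F`. The measurable supersets
`B n := {∃ q ∈ S, ∀ e ∈ Q ∩ E, dist e (r (q ∧ (T+1))) < dS/2 →
  (∃ q' ∈ S, dist e (r (q' ∧ (T+1))) < 1/(n+1)) ∨ infDist e ∂E < 1/(n+1)}`
(`S` a countable dense set of times; marginal measurability `measurable_sleTrace` and continuity
of `ψ̄ ∘ liftIm 0`) decrease in `n`; a sample in every `B n` yields bad times `pₙ ∈ [0, T + 1]`, a
convergent subsequence, and a contradiction with the positivity above at the limit time, so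
`⋂ B n` is null; continuity from above (`tendsto_measure_iInter_atTop`) gives `P' (B n) ≤ β` for
some `n`, and the event of the statement with `d' := 1/(n+1)` is contained in `B n` by continuity
of `r`, density of `S` and `infDist_lt_iff`. This imitates
`PathUpgradeRRangeBound.exists_measure_tail_le` and `PathUpgradeRSLERegBd`.
-/

noncomputable section

open scoped ENNReal NNReal Topology
open MeasureTheory Filter Set Metric TopologicalSpace
open Literature.Probability Literature.Probability.RandomPlanarGeometry
open UpperHalfPlane (upperHalfPlaneSet)

namespace Summit.CriticalPhenomena.SAWScalingLimit.Theorems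

namespace PathUpgradeRSLERegPor

/-- If the range of a curve `γ` in the closed upper half-plane has empty interior, then no
nonempty open subset of the Jordan domain `D` is covered by the image curve `φ̄ ∘ γ`: its
`φ`-preimage in `ℍ` would be a nonempty open subset of `range γ` (`φ̄` is injective on the closed
half-plane and agrees with `φ` on `ℍ`). [folklore] -/
theorem not_subset_range_of_interior_eq_empty {D : DobrushinDomain}
    (φ : ConformalEquiv upperHalfPlaneSet D.carrier) {γ : ℝ≥0 → ℂ} (him : ∀ t, 0 ≤ (γ t).im)
    (hint : interior (range γ) = ∅) {V : Set ℂ} (hVo : IsOpen V) (hVne : V.Nonempty)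
    (hVD : V ⊆ D.carrier) : ¬ V ⊆ range fun t ↦ φ.boundaryExtension (γ t) := by
  intro hV
  have hWo : IsOpen (upperHalfPlaneSet ∩ φ ⁻¹' V) :=
    φ.continuousOn.isOpen_inter_preimage UpperHalfPlane.isOpen_upperHalfPlaneSet hVo
  have hWsub : upperHalfPlaneSet ∩ φ ⁻¹' V ⊆ range γ := by
    rintro z ⟨hz, hzV⟩
    obtain ⟨t, ht⟩ := hV hzV
    exact ⟨t, JordanDomain.injOn_boundaryExtension φ (him t) (show 0 < z.im from hz).le
      (ht.trans (φ.boundaryExtension_eq hz).symm)⟩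
  obtain ⟨x, hx⟩ := hVne
  have hxW : φ.symm x ∈ upperHalfPlaneSet ∩ φ ⁻¹' V :=
    ⟨φ.symm_mapsTo (hVD hx), show φ (φ.symm x) ∈ V by rwa [φ.apply_symm_apply (hVD hx)]⟩
  have h : φ.symm x ∈ interior (range γ) := interior_maximal hWsub hWo hxW
  rw [hint] at h
  exact h

/-- Pointwise porosity of the image arc: if `range γ` has empty interior (and `γ` is a continuous
curve in the closed half-plane), then for every time `p`, every radius `ρ > 0`, every compact set
of times `K` and every dense `Q ⊆ ℂ` there is a point `e ∈ Q ∩ D` with `dist e (φ̄ (γ p)) < ρ` at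
positive distance from the closed set `φ̄ ∘ γ '' K ∪ ∂D`: the point `φ̄ (γ p)` lies in `closure D`
(Carathéodory), so `ball (φ̄ (γ p)) ρ ∩ D` is a nonempty open set, not covered by the arc.
[folklore] -/
theorem exists_mem_infDist_pos {D : DobrushinDomain}
    (φ : ConformalEquiv upperHalfPlaneSet D.carrier) {γ : ℝ≥0 → ℂ} (hγc : Continuous γ)
    (him : ∀ t, 0 ≤ (γ t).im) (hint : interior (range γ) = ∅) {Q : Set ℂ} (hQ : Dense Q)
    {K : Set ℝ≥0} (hK : IsCompact K) {ρ : ℝ} (hρ : 0 < ρ) (p : ℝ≥0) :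
    ∃ e ∈ Q, e ∈ D.carrier ∧ dist e (φ.boundaryExtension (γ p)) < ρ ∧
      0 < infDist e ((fun t ↦ φ.boundaryExtension (γ t)) '' K ∪ frontier D.carrier) := by
  have hcl' : ∀ t, γ t ∈ closure upperHalfPlaneSet := fun t ↦ by
    rw [ConformalEquiv.closure_upperHalfPlaneSet_eq]
    exact him t
  have hrc : Continuous fun t ↦ φ.boundaryExtension (γ t) :=
    (JordanDomain.continuousOn_boundaryExtension_holds D.toJordanDomain φ).comp_continuous hγc hcl'
  have hcl : φ.boundaryExtension (γ p) ∈ closure D.carrier :=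
    JordanDomain.mapsTo_boundaryExtension_holds D.toJordanDomain φ (hcl' p)
  obtain ⟨b, hbD, hbd⟩ := Metric.mem_closure_iff.1 hcl ρ hρ
  have hAc : IsClosed ((fun t ↦ φ.boundaryExtension (γ t)) '' K) := (hK.image hrc).isClosed
  have hO : IsOpen ((ball (φ.boundaryExtension (γ p)) ρ ∩ D.carrier) \
      (fun t ↦ φ.boundaryExtension (γ t)) '' K) :=
    (isOpen_ball.inter D.isOpen).sdiff hAc
  have hOne : ((ball (φ.boundaryExtension (γ p)) ρ ∩ D.carrier) \
      (fun t ↦ φ.boundaryExtension (γ t)) '' K).Nonempty := by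
    by_contra h
    rw [not_nonempty_iff_eq_empty, sdiff_eq_empty] at h
    exact not_subset_range_of_interior_eq_empty φ him hint (isOpen_ball.inter D.isOpen)
      ⟨b, mem_ball'.2 hbd, hbD⟩ inter_subset_right (h.trans (image_subset_range _ _))
  obtain ⟨e, heQ, ⟨heB, heD⟩, heK⟩ := hQ.exists_mem_open hO hOne
  refine ⟨e, heQ, heD, mem_ball.1 heB, ?_⟩
  refine ((hAc.union isClosed_frontier).notMem_iff_infDist_pos
    ⟨_, mem_union_right _ (D.boundary_mem_frontier 0)⟩).1 ?_
  rintro (h | h)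
  · exact heK h
  · have h2 := h.2
    rw [D.isOpen.interior_eq] at h2
    exact h2 heD

/-- Deterministic core of the null-intersection step: if `range γ` has empty interior, it is
impossible that for every `n` some time `pₙ ∈ [0, T']` is `1/(n+1)`-bad, i.e. every point of
`Q ∩ D` within `ρ` of `φ̄ (γ pₙ)` is within `1/(n+1)` of `φ̄ ∘ γ '' [0, T'] ∪ ∂D`: along a
convergent subsequence `pₙ → u`, the good point near `φ̄ (γ u)` of `exists_mem_infDist_pos` is
eventually `ρ`-close to `φ̄ (γ pₙ)` and at distance `> 1/(n+1)` from the closed set. [folklore] -/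
theorem not_forall_exists_bad {D : DobrushinDomain}
    (φ : ConformalEquiv upperHalfPlaneSet D.carrier) {γ : ℝ≥0 → ℂ} (hγc : Continuous γ)
    (him : ∀ t, 0 ≤ (γ t).im) (hint : interior (range γ) = ∅) {Q : Set ℂ} (hQ : Dense Q)
    (T' : ℝ≥0) {ρ : ℝ} (hρ : 0 < ρ)
    (hbad : ∀ n : ℕ, ∃ p ∈ Icc (0 : ℝ≥0) T', ∀ e ∈ Q, e ∈ D.carrier →
      dist e (φ.boundaryExtension (γ p)) < ρ →
        infDist e ((fun t ↦ φ.boundaryExtension (γ t)) '' Icc 0 T' ∪ frontier D.carrier) <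
          1 / ((n : ℝ) + 1)) : False := by
  choose p hpK hp using hbad
  obtain ⟨u, -, θ, hθ, hlim⟩ := isCompact_Icc.tendsto_subseq hpK
  obtain ⟨e, heQ, heD, hed, hepos⟩ :=
    exists_mem_infDist_pos φ hγc him hint hQ isCompact_Icc hρ u
  have hcl' : ∀ t, γ t ∈ closure upperHalfPlaneSet := fun t ↦ by
    rw [ConformalEquiv.closure_upperHalfPlaneSet_eq]
    exact him t
  have hrc : Continuous fun t ↦ φ.boundaryExtension (γ t) :=
    (JordanDomain.continuousOn_boundaryExtension_holds D.toJordanDomain φ).comp_continuous hγc hcl'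
  have h1 : ∀ᶠ k in atTop, dist e (φ.boundaryExtension (γ (p (θ k)))) < ρ :=
    (((continuous_const.dist hrc).tendsto u).comp hlim).eventually_lt_const hed
  have h2 : ∀ᶠ k : ℕ in atTop, 1 / ((k : ℝ) + 1) <
      infDist e ((fun t ↦ φ.boundaryExtension (γ t)) '' Icc 0 T' ∪ frontier D.carrier) :=
    tendsto_one_div_add_atTop_nhds_zero_nat.eventually_lt_const hepos
  obtain ⟨k, hk1, hk2⟩ := (h1.and h2).exists
  have h3 := hp (θ k) e heQ heD hk1
  have h4 : (1 : ℝ) / ((θ k : ℕ) + 1) ≤ 1 / ((k : ℝ) + 1) := Nat.one_div_le_one_div (hθ.id_le k)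
  linarith

/-- The SLE porosity quantile, general `0 < κ < 8`: for a conformal equivalence `φ : ℍ ≃ D`, a
horizon `T`, `dS > 0` and `β > 0`, some `d' > 0` has
`P' {∃ u ≤ T + 1, ∀ e ∈ D, dist e (φ̄ (γ u)) ≤ dS → infDist e (φ̄ ∘ γ '' [0, T+1] ∪ ∂D) < d'} ≤ β`.
See the module docstring for the proof (a.s. empty interior of the trace, measurable supersets
indexed by countable dense sets of times and points, continuity from above). [folklore] -/
theorem exists_measure_porous_le {κ : ℝ≥0} (h0 : 0 < κ) (h8 : κ < 8) {D : DobrushinDomain}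
    (φ : ConformalEquiv upperHalfPlaneSet D.carrier) (T : ℝ≥0) {dS : ℝ} (hdS : 0 < dS)
    {β : ℝ≥0∞} (hβ : 0 < β) :
    ∃ d' : ℝ, 0 < d' ∧ Process.preWienerMeasure {ω | ∃ u : ℝ≥0, (u : ℝ) ≤ T + 1 ∧
      ∀ e ∈ D.carrier, dist e (φ.boundaryExtension (sleTrace κ ω u)) ≤ dS →
        infDist e ((fun v ↦ φ.boundaryExtension (sleTrace κ ω v)) '' Icc 0 (T + 1) ∪
          frontier D.carrier) < d'} ≤ β := by
  haveI : IsProbabilityMeasure Process.preWienerMeasure := isProbabilityMeasure_preWienerMeasure'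
  have hΦc : Continuous fun z ↦ φ.boundaryExtension (Loewner.liftIm 0 z) :=
    continuous_boundaryExtension_liftIm φ
  have hΦeq : ∀ (ω : ℝ≥0 → ℝ) (t : ℝ≥0),
      φ.boundaryExtension (Loewner.liftIm 0 (sleTrace κ ω t)) =
        φ.boundaryExtension (sleTrace κ ω t) := fun ω t ↦ by
    rw [Loewner.liftIm_of_le (sleTrace_im_nonneg κ ω t)]
  have hRm : ∀ q : ℝ≥0, Measurable fun ω : ℝ≥0 → ℝ ↦
      φ.boundaryExtension (Loewner.liftIm 0 (sleTrace κ ω (min q (T + 1)))) := fun q ↦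
    hΦc.measurable.comp (measurable_sleTrace κ _)
  have hRc : ∀ ω : ℝ≥0 → ℝ, Continuous fun q : ℝ≥0 ↦
      φ.boundaryExtension (Loewner.liftIm 0 (sleTrace κ ω (min q (T + 1)))) := fun ω ↦
    hΦc.comp ((continuous_sleTrace κ ω).comp (continuous_id.min continuous_const))
  obtain ⟨S, hSc, hSd⟩ := TopologicalSpace.exists_countable_dense ℝ≥0
  obtain ⟨Q, hQc, hQd⟩ := TopologicalSpace.exists_countable_dense ℂ
  haveI : Countable S := hSc.to_subtype
  haveI : Countable ↥(Q ∩ D.carrier) := (hQc.mono inter_subset_left).to_subtype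
  obtain ⟨B, hBmem⟩ : ∃ B : ℕ → Set (ℝ≥0 → ℝ), ∀ n ω, ω ∈ B n ↔ ∃ q : S, ∀ e : ↥(Q ∩ D.carrier),
      dist (e : ℂ) (φ.boundaryExtension (Loewner.liftIm 0 (sleTrace κ ω (min q (T + 1))))) <
        dS / 2 →
      (∃ q' : S, dist (e : ℂ)
        (φ.boundaryExtension (Loewner.liftIm 0 (sleTrace κ ω (min q' (T + 1))))) <
          1 / ((n : ℝ) + 1)) ∨ infDist (e : ℂ) (frontier D.carrier) < 1 / ((n : ℝ) + 1) :=
    ⟨fun n ↦ {ω | ∃ q : S, ∀ e : ↥(Q ∩ D.carrier),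
      dist (e : ℂ) (φ.boundaryExtension (Loewner.liftIm 0 (sleTrace κ ω (min q (T + 1))))) <
        dS / 2 →
      (∃ q' : S, dist (e : ℂ)
        (φ.boundaryExtension (Loewner.liftIm 0 (sleTrace κ ω (min q' (T + 1))))) <
          1 / ((n : ℝ) + 1)) ∨ infDist (e : ℂ) (frontier D.carrier) < 1 / ((n : ℝ) + 1)},
      fun _ _ ↦ Iff.rfl⟩
  have hDm : ∀ (e : ℂ) (q : ℝ≥0) (c : ℝ), Measurable fun ω : ℝ≥0 → ℝ ↦
      dist e (φ.boundaryExtension (Loewner.liftIm 0 (sleTrace κ ω (min q (T + 1))))) < c :=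
    fun e q c ↦ measurableSet_setOf.1 (measurableSet_lt (measurable_const.dist (hRm q))
      measurable_const)
  have hBm : ∀ n, MeasurableSet (B n) := fun n ↦ by
    rw [show B n = {ω | ω ∈ B n} from rfl]
    simp only [hBmem]
    exact measurableSet_setOf.2 (Measurable.exists fun q ↦ Measurable.forall fun e ↦
      (hDm _ _ _).imp ((Measurable.exists fun q' ↦ hDm _ _ _).or measurable_const))
  have hanti : Antitone B := fun n n' hnn' ω hω ↦ by
    obtain ⟨q, hq⟩ := (hBmem n' ω).1 hω
    refine (hBmem n ω).2 ⟨q, fun e hed ↦ ?_⟩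
    rcases hq e hed with ⟨q', hq'⟩ | h
    · exact Or.inl ⟨q', hq'.trans_le (Nat.one_div_le_one_div hnn')⟩
    · exact Or.inr (h.trans_le (Nat.one_div_le_one_div hnn'))
  have hne : ∀ ω : ℝ≥0 → ℝ, ((fun v ↦ φ.boundaryExtension (sleTrace κ ω v)) '' Icc 0 (T + 1) ∪
      frontier D.carrier).Nonempty := fun ω ↦ ⟨_, mem_union_right _ (D.boundary_mem_frontier 0)⟩
  have hnull : Process.preWienerMeasure (⋂ n, B n) = 0 := by
    rw [measure_eq_zero_iff_ae_notMem]
    filter_upwards [ae_interior_range_sleTrace_eq_empty_of_lt_eight h0 h8] with ω hω hmem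
    refine not_forall_exists_bad φ (continuous_sleTrace κ ω) (sleTrace_im_nonneg κ ω) hω hQd
      (T + 1) (half_pos hdS) fun n ↦ ?_
    obtain ⟨q, hq⟩ := (hBmem n ω).1 (mem_iInter.1 hmem n)
    refine ⟨min q (T + 1), ⟨zero_le, min_le_right _ _⟩, fun e heQ heD hed ↦ ?_⟩
    rcases hq ⟨e, heQ, heD⟩ (by rwa [hΦeq]) with ⟨q', hq'⟩ | hfr
    · rw [hΦeq] at hq'
      exact (infDist_le_dist_of_mem (mem_union_left _ (mem_image_of_mem
        (fun v ↦ φ.boundaryExtension (sleTrace κ ω v))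
        (show min (q' : ℝ≥0) (T + 1) ∈ Icc 0 (T + 1) from ⟨zero_le, min_le_right _ _⟩)))).trans_lt hq'
    · exact (infDist_le_infDist_of_subset subset_union_right
        ⟨_, D.boundary_mem_frontier 0⟩).trans_lt hfr
  have htend := tendsto_measure_iInter_atTop (μ := Process.preWienerMeasure)
    (fun n ↦ (hBm n).nullMeasurableSet) hanti ⟨0, measure_ne_top _ _⟩
  rw [hnull] at htend
  obtain ⟨n, hn⟩ := (htend.eventually_lt_const hβ).exists
  refine ⟨1 / ((n : ℝ) + 1), Nat.one_div_pos_of_nat, (measure_mono ?_).trans hn.le⟩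
  rintro ω ⟨u, huT, hωu⟩
  have huT' : u ≤ T + 1 := by exact_mod_cast huT
  have hopen : IsOpen {s : ℝ≥0 |
      dist (φ.boundaryExtension (Loewner.liftIm 0 (sleTrace κ ω (min s (T + 1)))))
        (φ.boundaryExtension (sleTrace κ ω u)) < dS / 2} :=
    isOpen_lt ((hRc ω).dist continuous_const) continuous_const
  have hu : u ∈ {s : ℝ≥0 |
      dist (φ.boundaryExtension (Loewner.liftIm 0 (sleTrace κ ω (min s (T + 1)))))
        (φ.boundaryExtension (sleTrace κ ω u)) < dS / 2} := by
    show dist _ _ < dS / 2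
    rw [min_eq_left huT', hΦeq, dist_self]
    exact half_pos hdS
  obtain ⟨q, hqS, hq⟩ := hSd.exists_mem_open hopen ⟨u, hu⟩
  refine (hBmem n ω).2 ⟨⟨q, hqS⟩, fun e hed ↦ ?_⟩
  have hq' : dist (φ.boundaryExtension (Loewner.liftIm 0 (sleTrace κ ω (min q (T + 1)))))
      (φ.boundaryExtension (sleTrace κ ω u)) < dS / 2 := hq
  have hdist : dist (e : ℂ) (φ.boundaryExtension (sleTrace κ ω u)) ≤ dS := by
    have := dist_triangle (e : ℂ)
      (φ.boundaryExtension (Loewner.liftIm 0 (sleTrace κ ω (min q (T + 1)))))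
      (φ.boundaryExtension (sleTrace κ ω u))
    linarith
  have hlt := hωu e e.2.2 hdist
  rw [infDist_lt_iff (hne ω)] at hlt
  obtain ⟨y, hy | hy, hyd⟩ := hlt
  · obtain ⟨v, hv, rfl⟩ := hy
    left
    have hopen' : IsOpen {s : ℝ≥0 | dist (e : ℂ)
        (φ.boundaryExtension (Loewner.liftIm 0 (sleTrace κ ω (min s (T + 1))))) <
          1 / ((n : ℝ) + 1)} :=
      isOpen_lt (continuous_const.dist (hRc ω)) continuous_const
    have hv' : v ∈ {s : ℝ≥0 | dist (e : ℂ)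
        (φ.boundaryExtension (Loewner.liftIm 0 (sleTrace κ ω (min s (T + 1))))) <
          1 / ((n : ℝ) + 1)} := by
      show dist _ _ < _
      rwa [min_eq_left hv.2, hΦeq]
    obtain ⟨q', hq'S, hq'⟩ := hSd.exists_mem_open hopen' ⟨v, hv'⟩
    exact ⟨⟨q', hq'S⟩, hq'⟩
  · exact Or.inr ((infDist_le_dist_of_mem hy).trans_lt hyd)

end PathUpgradeRSLERegPor

/-- **SLE porosity quantile** (registered stub `stub_slePor` of line `bidir_windows`): for the
SLE(8/3) reference sample seen in the Dobrushin domain `E` through the boundary extension of a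
chordal uniformizer `ψ`, `r := ψ̄ ∘ γ`, every horizon `T`, every `dS > 0` and every budget `β > 0`
admit a deterministic `d' > 0` with
`P' {∃ u ≤ T + 1, ∀ e ∈ E, dist e (r u) ≤ dS → infDist e (r '' [0, T+1] ∪ ∂E) < d'} ≤ β`
(a.s. empty interior of the trace for `κ = 8/3 < 8`, Carathéodory boundary correspondence,
compactness of the window, continuity from above). [folklore] -/
theorem stub_slePor : ∀ (E : Literature.Probability.RandomPlanarGeometry.DobrushinDomain) (ψ : Literature.Probability.RandomPlanarGeometry.ConformalEquiv UpperHalfPlane.upperHalfPlaneSet E.carrier), E.IsChordalUniformizing ψ → ∀ (T : NNReal) (dS : ℝ), 0 < dS → ∀ β : ENNReal, 0 < β → ∃ d' : ℝ, 0 < d' ∧ Literature.Probability.Process.preWienerMeasure {ω | ∃ u : NNReal, (u : ℝ) ≤ T + 1 ∧ ∀ e ∈ E.carrier, dist e (ψ.boundaryExtension (Literature.Probability.RandomPlanarGeometry.sleTrace ((8:NNReal)/3) ω u)) ≤ dS → Metric.infDist e ((fun v => ψ.boundaryExtension (Literature.Probability.RandomPlanarGeometry.sleTrace ((8:NNReal)/3)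 ω v)) '' Set.Icc 0 (T + 1) ∪ frontier E.carrier) < d'} ≤ β := by
  intro E ψ _ T dS hdS β hβ
  have hκ0 : (0 : ℝ≥0) < 8 / 3 := by positivity
  have hκ8 : (8 : ℝ≥0) / 3 < 8 := by
    rw [div_lt_iff₀ (by norm_num : (0 : ℝ≥0) < 3)]
    norm_num
  exact PathUpgradeRSLERegPor.exists_measure_porous_le hκ0 hκ8 ψ T hdS hβ

end Summit.CriticalPhenomena.SAWScalingLimit.Theorems

end
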